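import Summits.BirchSwinnertonDyer.BirchSwinnertonDyer.Theorems.ResidualThetaTransportAtTwoThetaLayerLambdaCongruenceAtTwoNonRootUnconditional
import Summits.BirchSwinnertonDyer.BirchSwinnertonDyer.Theorems.ResidualThetaTransportAtTwoThetaLayerLambdaCongruenceAtTwoStarPlusLineCharTwo
import Literature.NumberTheory.EllipticCurves.RationalIsogenyDegreesProofs
import HarnessLib

/-!
# Crux Kan⁺ `ThetaLayerLambdaCongruenceAtTwo` (stmt-BirchSwinnertonDyer-20688, route ResidualThetaTransportAtTwo), line `birth`:
# MAZUR–KENKU REMOVED — the crux BY NAME from FOUR print facts + Abbes–Ullmo + the route item 21437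

Width seat bsd-wall-rtt-p3-w3 g5 (`--supports stmt-BirchSwinnertonDyer-20688`; closes nothing; THEOREMS ONLY — no `def`,
no `sorry`; BSD is not proved by this).

WHY THIS FILE. In the landed (C3k)/(K2) chain of line `birth` (`…StarLevel.kTwo_of_dvd` → `…StarGalois.kTwo_of_dvd_of_facts` →
`…StarPlusLineCharTwo.plusLineCharTwo_of_facts`) the named fact `mazurKenku_exists_cyclic_isogeny` (Mazur 1978 Thm. 1 + Kenku 1982)
is used at exactly one place and only for its CYCLICITY clause: `obtain ⟨ψ, hcyc, -⟩ := hMK W A hiso` — a cyclic `ℚ`-isogeny from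
`W` to the optimal quotient `A` of the depleted form (its degree is then odd because `W`, good supersingular at `2`, has no rational
`2`-torsion, `…StarOddIsogeny`; Kenku's degree list is discarded). That clause is ELEMENTARY and a tree theorem:
`WeierstrassCurve.IsIsogenous.exists_isCyclic` (Silverman AEC Cor. III.4.11, `Literature/…/RationalIsogenyDegreesProofs`). Likewise the
Faltings binder is the tree theorem `isIsogenous_iff_frobeniusTrace_eq_holds`. This file re-threads the three theorems of the chain
without those two binders (statements otherwise VERBATIM, proofs copied with the two lines replaced) and closes:
* `plusLineCharTwo_of_fourFacts` — (C3k) in characteristic `2` from {ES, SD, Bz, Se};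
* `thetaLayerLambdaCongruenceAtTwo_of_fourFacts_flatMuZeroAtTwo` — the crux from {ES, SD, Bz, Se} + FLAT ((NR-g) unconditional,
  `…NonRootUnconditional.partnerEulerFactorNonRoot`);
* `kanP5_of_pub_of_signedMuAnalyticAtTwoPlus : ES → SD → Bz → Se → AU → SignedMuAnalyticAtTwoPlus → ThetaLayerLambdaCongruenceAtTwo` —
  **the twin KanP needs FIVE print binders** (Eichler–Shimura depleted optimal quotient, Hecke self-duality of `J₀[2]`, Buzzard 2000
  Prop. 2.4, Serre 1972 Prop. 12, Abbes–Ullmo Thm. A), down from eight in p612933.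

References: [SilvermanAEC2009] Cor. III.4.11; [DarmonDiamondTaylor1995] §1.6, §4.5; [Buzzard2000LevelLoweringModTwo] Prop. 2.4;
[AbbesUllmo1996] Thm. A; [Pollack2003] Conj. 6.3.
-/

noncomputable section

-- justification: the `Summit.BirchSwinnertonDyer.BirchSwinnertonDyer.…` path repeats a component (route-file convention)
set_option linter.dupNamespace false

open scoped MatrixGroups ComplexConjugate ModularForm NumberField

open CongruenceSubgroup Complex WeierstrassCurve IsDedekindDomain Polynomial Field Matrix Literature.NumberTheory.GaloisRepresentations
open Literature.NumberTheory.EllipticCurves Literature.NumberTheory.EllipticCurves.ModularForms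
open Literature.NumberTheory.EllipticCurves.Rank1Residual Rat.HeightOneSpectrum
open Summit.BirchSwinnertonDyer.BirchSwinnertonDyer.Theses.ResidualThetaTransportAtTwo

namespace Summit.BirchSwinnertonDyer.BirchSwinnertonDyer.Theorems.ThetaLayerLambdaCongruenceAtTwo

/-! ## §1. (K2) at the crux's own level without Mazur–Kenku / Faltings -/

/-- (MAZUR–KENKU- AND FALTINGS-FREE re-threading of `StarLevel.kTwo_of_dvd`: the cyclic `ℚ`-isogeny `W → A` is taken from the tree theorem `WeierstrassCurve.IsIsogenous.exists_isCyclic` (AEC III.4.11), and `W ~ A` from the tree theorem `isIsogenous_iff_frobeniusTrace_eq_holds`; statement otherwise verbatim.) **ITEM B5 and (K2) at the crux's own level, from the facts.** `W/ℚ` globally minimal, good supersingular at `2`, `Δ_W < 0`;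
newform `f` of level `N`; `S` a nonempty finite set of primes; a level `L` with `N·∏_{ℓ∈S} ℓ² ∣ L` and
`primes(L) ⊆ S` (so `S ⊇ primes(N)`); `𝔪₀ = span{2, T_q − a_q(W) (q ∤ L), T_ℓ (ℓ ∣ L)}`. Inputs: the flexible-level optimal-quotient fact
`eichlerShimura_depletedOptimalQuotient_periodLattice_of_dvd`, Faltings, Mazur–Kenku, Hecke self-duality
of `J₀(L)[2]`, and `hsub` (conclusion of `buzzard2000_multiplicityOne_gamma0` at `𝔪₀`). Conclusions: (a) `𝔪₀ ≠ ⊤`, `|𝕋/𝔪₀| = 2`,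
`𝔪₀` maximal; (b) (K2): every additive `K ⊇ 2Λ, (T_q^∨ − a_q(W))Λ, U_ℓ^∨Λ,` cusp-negation differences has
`x, y ∈ Λ ∖ K ⇒ x − y ∈ K`. [cite: DarmonDiamondTaylor1995, §1.6 Lemma 1.38 and §4.5 Thm. 4.26] -/
theorem kTwo_of_dvd_noMazur
    (hES : eichlerShimura_depletedOptimalQuotient_periodLattice_of_dvd)
    (hSD : heckeSelfDual_torsionBy_J0)
    (W : WeierstrassCurve ℚ) [W.IsElliptic] [W.IsGloballyMinimal] (hss : GoodSS W 2) (hΔ : W.Δ < 0)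
    {N : ℕ} [NeZero N] {f : CuspForm (Gamma0 N) 2} (hf : IsNewformOf W f)
    (S : Finset ℕ) (hS : ∀ ℓ ∈ S, ℓ.Prime) (hSne : S.Nonempty)
    (L : ℕ) [NeZero L] (hNL : N * ∏ ℓ ∈ S, ℓ ^ 2 ∣ L) (hLS : ∀ p : ℕ, p.Prime → p ∣ L → p ∈ S)
    (hsub : Module.finrank (HeckeRing0 L 2 ⧸ Ideal.span ({t : HeckeRing0 L 2 | t = 2 ∨ (∃ (q : ℕ) (hq : q.Prime), ¬ q ∣ L ∧
          t = HeckeRing0.T L 2 q hq - (W.LFunction q : HeckeRing0 L 2)) ∨ (∃ (q : ℕ) (hq : q.Prime), q ∣ L ∧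
          t = HeckeRing0.T L 2 q hq)}))
      (Submodule.torsionBySet (HeckeRing0 L 2) (J0 L) (Ideal.span ({t : HeckeRing0 L 2 | t = 2 ∨
          (∃ (q : ℕ) (hq : q.Prime), ¬ q ∣ L ∧ t = HeckeRing0.T L 2 q hq - (W.LFunction q : HeckeRing0 L 2)) ∨
          (∃ (q : ℕ) (hq : q.Prime), q ∣ L ∧ t = HeckeRing0.T L 2 q hq)}))) = 2)
    (K : AddSubgroup (Module.Dual ℂ (CuspForm (Gamma0 L) 2)))
    (h2K : ∀ x ∈ periodHomology L, (2 : ℂ) • x ∈ K)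
    (hTK : ∀ (q : ℕ) (hq : q.Prime), ¬ q ∣ L → ∀ x ∈ periodHomology L,
      (haveI : NeZero q := ⟨hq.ne_zero⟩; heckeT (Gamma0 L) 2 q).dualMap x - (W.LFunction q : ℂ) • x ∈ K)
    (hUK : ∀ (q : ℕ) (hq : q.Prime), q ∣ L → ∀ x ∈ periodHomology L,
      (haveI : NeZero q := ⟨hq.ne_zero⟩; heckeT (Gamma0 L) 2 q).dualMap x ∈ K)
    (hcK : ∀ γ : Gamma0 L, periodFunctional L ⟨iotaConj (γ : SL(2, ℤ)), iotaConj_coe_mem_gamma0 γ⟩ - periodFunctional L γ ∈ K)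
    {x y : Module.Dual ℂ (CuspForm (Gamma0 L) 2)} (hx : x ∈ periodHomology L) (hy : y ∈ periodHomology L)
    (hxK : x ∉ K) (hyK : y ∉ K) : x - y ∈ K := by
  classical
  set G : Set (HeckeRing0 L 2) := {t : HeckeRing0 L 2 | t = 2 ∨ (∃ (q : ℕ) (hq : q.Prime), ¬ q ∣ L ∧
      t = HeckeRing0.T L 2 q hq - (W.LFunction q : HeckeRing0 L 2)) ∨ (∃ (q : ℕ) (hq : q.Prime), q ∣ L ∧
      t = HeckeRing0.T L 2 q hq)} with hGdef
  -- the depleted form at level `L`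
  have hint : ∀ n : ℕ, ∃ z : ℤ, cuspCoeff f n = z := fun n ↦ ⟨W.LFunction n, hf.2 n⟩
  have hTf : ∀ (p : ℕ) (hp : p.Prime), (haveI : NeZero p := ⟨hp.ne_zero⟩; heckeT (Gamma0 N) 2 p f) = cuspCoeff f p • f :=
    fun p hp ↦ by haveI : NeZero p := ⟨hp.ne_zero⟩; exact hf.1.heckeT_eq_coeff_smul hp
  have hLS' : ∀ p : ℕ, p.Prime → p ∣ L → p ∣ N ∨ p ∈ S := fun p hp h ↦ Or.inr (hLS p hp h)
  obtain ⟨g, hg', hgi, hgr, hg1, hgT, hgU, hgall⟩ := exists_depleted_eigenform_of_dvd f hint hf.1.2.2 hTf S hS L hNL hLS'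
  have hg : ∀ n : ℕ, cuspCoeff g n = if ∃ ℓ ∈ S, ℓ ∣ n then 0 else (W.LFunction n : ℂ) := fun n ↦ by rw [hg' n, hf.2 n]
  -- primes of `L` are exactly `S`
  have hSL : ∀ ℓ ∈ S, ℓ ∣ L := fun ℓ hℓ ↦ (dvd_level_of_mem (M := N) (S := S) rfl hℓ).trans hNL
  have hLiff : ∀ q : ℕ, q.Prime → (q ∣ L ↔ q ∈ S) := fun q hq ↦ ⟨hLS q hq, hSL q⟩
  -- the optimal quotient and `W ~ A`
  obtain ⟨A, hAell, hAmin, LA, c, hLA, hc, hlat, hfin⟩ := hES N f hf.1 hint S hS hSne L hNL hLS' g hg'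
  have hiso : IsIsogenous W A := by
    refine (WeierstrassCurve.isIsogenous_iff_frobeniusTrace_eq_holds W A).mpr ?_
    set D : ℤ := W.minimalDiscriminantInt with hD
    have hD0 : D ≠ 0 := W.minimalDiscriminantInt_ne_zero
    refine ((Set.finite_Iic D.natAbs).union ((S : Set ℕ).toFinite.union hfin)).subset ?_
    rintro p ⟨hp, hne⟩
    by_contra hmem
    simp only [Set.mem_union, Set.mem_Iic, Finset.mem_coe, Set.mem_setOf_eq, not_or] at hmem
    obtain ⟨hpD, hpS, hpA⟩ := hmem
    haveI : Fact p.Prime := ⟨hp⟩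
    have hndvd : ¬ (p : ℤ) ∣ D := fun h ↦ hpD (Nat.le_of_dvd (Int.natAbs_pos.mpr hD0) (Int.ofNat_dvd_left.mp h))
    have hgood : W.HasGoodReductionAtPrime p := hasGoodReductionAtPrime_of_not_dvd W p hndvd
    have h1 : (W.LFunction p : ℂ) = ((W.frobeniusTrace p : ℤ) : ℂ) := by
      rw [LFunction_apply_prime_eq_frobeniusTrace W p hgood]
    have h2' : cuspCoeff g p = (W.LFunction p : ℂ) := by
      rw [hg p, if_neg]
      rintro ⟨ℓ, hℓ, hd⟩
      exact hpS (((Nat.prime_dvd_prime_iff_eq (hS ℓ hℓ) hp).mp hd) ▸ hℓ)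
    have h3 : ((A.frobeniusTrace p : ℤ) : ℂ) = cuspCoeff g p := by
      by_contra h; exact hpA ⟨hp, h⟩
    apply hne
    have : ((W.frobeniusTrace p : ℤ) : ℂ) = ((A.frobeniusTrace p : ℤ) : ℂ) := by rw [← h1, ← h2', h3]
    exact_mod_cast this
  obtain ⟨ψ, hcyc⟩ := hiso.exists_isCyclic
  -- the eigen-ideal acts on `g` by even integers and contains `2`
  have h2 : (2 : HeckeRing0 L 2) ∈ Ideal.span G := Ideal.subset_span (Or.inl rfl)
  have hb : ∀ (q : ℕ) (hq : q.Prime), (haveI : NeZero q := ⟨hq.ne_zero⟩; heckeT (Gamma0 L) 2 q g) =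
      (((if q ∈ S then 0 else W.LFunction q : ℤ)) : ℂ) • g := fun q hq ↦ by
    rw [hgall q hq, hg q]
    by_cases hqS : q ∈ S
    · rw [if_pos ⟨q, hqS, dvd_rfl⟩, if_pos hqS, Int.cast_zero]
    · rw [if_neg, if_neg hqS]
      rintro ⟨ℓ, hℓ, hd⟩
      exact hqS (((Nat.prime_dvd_prime_iff_eq (hS ℓ hℓ) hq).mp hd) ▸ hℓ)
  have h𝔪 : ∀ t ∈ Ideal.span G, ∃ e : ℤ, HeckeRing0.toEnd L 2 t g = ((2 * e : ℤ) : ℂ) • g := by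
    refine ideal_span_acts_even g (fun q ↦ if q ∈ S then 0 else W.LFunction q) hb G fun t ht ↦ ?_
    rcases ht with rfl | ⟨q, hq, hqL, rfl⟩ | ⟨q, hq, hqL, rfl⟩
    · exact Or.inl rfl
    · refine Or.inr ⟨q, hq, ?_⟩
      rw [if_neg (fun h ↦ hqL ((hLiff q hq).mpr h))]
    · refine Or.inr ⟨q, hq, ?_⟩
      rw [if_pos ((hLiff q hq).mp hqL), Int.cast_zero, sub_zero]
  -- B5 at level `L`: a witness outside `𝔪₀Λ`, hence `𝔪₀ ≠ ⊤`, `|𝕋/𝔪₀| = 2`, maximal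
  obtain ⟨γ₀, hγ₀⟩ := exists_periodFunctional_iotaConj_add_notMem_of_optimalQuotient W hss hΔ g hgr A hLA hc hlat ψ hcyc
    (Ideal.span G) h𝔪
  have hne : Ideal.span G ≠ ⊤ := by
    intro htop
    apply hγ₀
    rw [htop, Submodule.top_smul]
    exact (mem_periodHomologyHecke L).mpr
      (add_mem (periodFunctional_mem_periodHomology L _) (periodFunctional_mem_periodHomology L γ₀))
  have hq := natCard_quotient_eq_two_of_ne_top (Ideal.span G) h2 (eigenIdeal_T_sub_int_mem W) hne
  haveI : (Ideal.span G).IsMaximal := isMaximal_of_natCard_quotient_eq_two _ hq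
  -- B4 quotient form from `hsub` and the self-duality pairing, then the (K2) glue
  obtain ⟨B, hbal, hleft, -⟩ := hSD L 2
  obtain ⟨v₁, -, v₂, hv₂, hcos⟩ := exists_fourCosets_periodHomology_of_multiplicityOne _ h2 hq hsub B hbal hleft
  have hK𝔪 : ∀ z ∈ Ideal.span G • periodHomologyHecke L, z ∈ K := by
    refine mem_of_mem_ideal_span_smul G K fun s hs z hz ↦ ?_
    rcases hs with rfl | ⟨q, hq', hqL, rfl⟩ | ⟨q, hq', hqL, rfl⟩
    · have : (2 : HeckeRing0 L 2) • z = (2 : ℂ) • z := by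
        rw [show (2 : HeckeRing0 L 2) = ((2 : ℤ) : HeckeRing0 L 2) by norm_num, heckeRing0_intCast_smul, Int.cast_ofNat]
      rw [this]
      exact h2K z hz
    · rw [sub_smul, heckeRing0_T_smul, heckeRing0_intCast_smul]
      exact hTK q hq' hqL z hz
    · rw [heckeRing0_T_smul]
      exact hUK q hq' hqL z hz
  exact indexTwo_of_fourCosets_of_optimalQuotient W hss hΔ g hgr A hLA hc hlat ψ hcyc (Ideal.span G) h2 h𝔪 K hK𝔪 hcK hv₂
    hcos hx hy hxK hyK

/-! ## §2. (K2) from the three facts {ES, SD} + {Bz, Se} (no `hsub`) -/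

/-- (MAZUR–KENKU- AND FALTINGS-FREE re-threading of `StarGalois.kTwo_of_dvd_of_facts`; statement otherwise verbatim.) **(K2) at the crux's own level, from named facts only (no `hsub`).**  As `StarLevel.kTwo_of_dvd` — `W/ℚ`
globally minimal, `GoodSS W 2`, `Δ_W < 0`, newform `f` of level `N`, `S` a nonempty finite set of primes, a level
`L` with `N·∏_{ℓ∈S} ℓ² ∣ L` and `primes(L) ⊆ S`, `𝔪₀ = span{2, T_q − a_q(W) (q ∤ L), T_ℓ (ℓ ∣ L)}` — plus `L` odd
and good reduction of `W` at every prime `p ∤ 2L`; the input `hsub` of `kTwo_of_dvd` is now supplied by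
`finrank_torsionBySet_eq_two_of_facts` (Buzzard's mod-`2` multiplicity one, whose Galois-side hypotheses are
discharged from Serre's Prop. 12 at the supersingular prime `2`), after the case split `𝔪₀ = ⊤` (vacuous:
`K ⊇ 𝔪₀Λ = Λ`) / `𝔪₀ ≠ ⊤` (then `|𝕋/𝔪₀| = 2`, `𝔪₀` maximal, `StarKTwoOfFacts`).  Conclusion (K2): every additive
`K ⊇ 2Λ, (T_q^∨ − a_q(W))Λ, U_ℓ^∨Λ,` cusp-negation differences has `x, y ∈ Λ ∖ K ⇒ x − y ∈ K`.  Named facts used: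
`eichlerShimura_depletedOptimalQuotient_periodLattice_of_dvd`, `isIsogenous_iff_frobeniusTrace_eq` (Faltings),
`mazurKenku_exists_cyclic_isogeny`, `heckeSelfDual_torsionBy_J0`, `buzzard2000_multiplicityOne_gamma0`,
`serre1972_supersingular_decompositionSubgroup_image`.
[cite: Buzzard2000LevelLoweringModTwo, Prop. 2.4 and Def. 2.1–2.2 (p. 100–101)]
[cite: DarmonDiamondTaylor1995, §1.6 Lemma 1.38 and §4.5 Thm. 4.26] -/
theorem kTwo_of_dvd_of_threeFacts
    (hES : eichlerShimura_depletedOptimalQuotient_periodLattice_of_dvd)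
    (hSD : heckeSelfDual_torsionBy_J0) (hBz : buzzard2000_multiplicityOne_gamma0)
    (hSe : serre1972_supersingular_decompositionSubgroup_image)
    (W : WeierstrassCurve ℚ) [W.IsElliptic] [W.IsGloballyMinimal] (hss : GoodSS W 2) (hΔ : W.Δ < 0)
    {N : ℕ} [NeZero N] {f : CuspForm (Gamma0 N) 2} (hf : IsNewformOf W f)
    (S : Finset ℕ) (hS : ∀ ℓ ∈ S, ℓ.Prime) (hSne : S.Nonempty)
    (L : ℕ) [NeZero L] (hL : Odd L) (hNL : N * ∏ ℓ ∈ S, ℓ ^ 2 ∣ L) (hLS : ∀ p : ℕ, p.Prime → p ∣ L → p ∈ S)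
    (hgood : ∀ v : HeightOneSpectrum (𝓞 ℚ), ¬ ((primesEquiv v : ℕ) ∣ 2 * L) → W.HasGoodReductionAt v)
    (K : AddSubgroup (Module.Dual ℂ (CuspForm (Gamma0 L) 2)))
    (h2K : ∀ x ∈ periodHomology L, (2 : ℂ) • x ∈ K)
    (hTK : ∀ (q : ℕ) (hq : q.Prime), ¬ q ∣ L → ∀ x ∈ periodHomology L,
      (haveI : NeZero q := ⟨hq.ne_zero⟩; heckeT (Gamma0 L) 2 q).dualMap x - (W.LFunction q : ℂ) • x ∈ K)
    (hUK : ∀ (q : ℕ) (hq : q.Prime), q ∣ L → ∀ x ∈ periodHomology L,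
      (haveI : NeZero q := ⟨hq.ne_zero⟩; heckeT (Gamma0 L) 2 q).dualMap x ∈ K)
    (hcK : ∀ γ : Gamma0 L, periodFunctional L ⟨iotaConj (γ : SL(2, ℤ)), iotaConj_coe_mem_gamma0 γ⟩ - periodFunctional L γ ∈ K)
    {x y : Module.Dual ℂ (CuspForm (Gamma0 L) 2)} (hx : x ∈ periodHomology L) (hy : y ∈ periodHomology L)
    (hxK : x ∉ K) (hyK : y ∉ K) : x - y ∈ K := by
  classical
  set G : Set (HeckeRing0 L 2) := {t : HeckeRing0 L 2 | t = 2 ∨ (∃ (q : ℕ) (hq : q.Prime), ¬ q ∣ L ∧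
      t = HeckeRing0.T L 2 q hq - (W.LFunction q : HeckeRing0 L 2)) ∨ (∃ (q : ℕ) (hq : q.Prime), q ∣ L ∧
      t = HeckeRing0.T L 2 q hq)} with hGdef
  by_cases hne : Ideal.span G = ⊤
  · -- vacuous case: `K ⊇ 𝔪₀Λ = Λ ∋ x`
    exfalso
    apply hxK
    have hK𝔪 : ∀ z ∈ Ideal.span G • periodHomologyHecke L, z ∈ K := by
      refine mem_of_mem_ideal_span_smul G K fun s hs z hz ↦ ?_
      rcases hs with rfl | ⟨q, hq', hqL, rfl⟩ | ⟨q, hq', hqL, rfl⟩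
      · have : (2 : HeckeRing0 L 2) • z = (2 : ℂ) • z := by
          rw [show (2 : HeckeRing0 L 2) = ((2 : ℤ) : HeckeRing0 L 2) by norm_num, heckeRing0_intCast_smul, Int.cast_ofNat]
        rw [this]
        exact h2K z hz
      · rw [sub_smul, heckeRing0_T_smul, heckeRing0_intCast_smul]
        exact hTK q hq' hqL z hz
      · rw [heckeRing0_T_smul]
        exact hUK q hq' hqL z hz
    apply hK𝔪
    rw [hne, Submodule.top_smul]
    exact (mem_periodHomologyHecke L).mpr hx
  · have h2 : (2 : HeckeRing0 L 2) ∈ Ideal.span G := Ideal.subset_span (Or.inl rfl)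
    have hq := natCard_quotient_eq_two_of_ne_top (Ideal.span G) h2 (eigenIdeal_T_sub_int_mem W) hne
    haveI h𝔪 : (Ideal.span G).IsMaximal := isMaximal_of_natCard_quotient_eq_two _ hq
    have hT : ∀ (q : ℕ) (hq' : q.Prime), ¬ q ∣ L →
        HeckeRing0.T L 2 q hq' - (W.LFunction q : HeckeRing0 L 2) ∈ Ideal.span G :=
      fun q hq' hqL ↦ Ideal.subset_span (Or.inr (Or.inl ⟨q, hq', hqL, rfl⟩))
    have hsub := finrank_torsionBySet_eq_two_of_facts hBz hSe W hss L hL hgood (Ideal.span G) h𝔪 h2 hq hT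
    exact kTwo_of_dvd_noMazur hES hSD W hss hΔ hf S hS hSne L hNL hLS hsub K h2K hTK hUK hcK hx hy hxK hyK

/-! ## §3. (C3k) in characteristic `2` from four facts -/


/-- (MAZUR–KENKU- AND FALTINGS-FREE re-threading of `StarPlusLineCharTwo.plusLineCharTwo_of_facts`: four named facts instead of six; statement otherwise verbatim.) **(C3k) «plus multiplicity one over fields of characteristic `2`» at every level of the crux's shape, from named
facts.**  The registered stub `stub_plusLineCharTwo` of line `birth` with its hypothesis «`N'` odd and divisible by the
primes of `N_W`» strengthened to the level hypothesis of `kTwo_of_dvd_of_facts`: a newform `f` of `W` of level `N`, a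
nonempty finite set of primes `S` with `N·∏_{ℓ∈S} ℓ² ∣ N'` and `primes(N') ⊆ S`, and good reduction of `W` at every prime
`p ∤ 2N'` (all satisfied at the crux's level `N' = N_W·M·∏_{v∈S₀} q_v²`).  Then for every field `k` of characteristic `2`
and all nonzero even `1`-periodic Γ₀(N')-symbol functions `Ψ₁, Ψ₂ : ℚ → k` that are exact Hecke eigenfunctions for
`T_q ↦ a_q(W)` (`q ∤ N'`) and `U_ℓ ↦ 0` (`ℓ ∣ N'`): `Ψ₂ = c·Ψ₁`.  Proof: §2 with (K2) = `kTwo_of_dvd_of_facts`; `2 ∣ a₂(W)`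
from `GoodSS W 2`.  Named facts: `eichlerShimura_depletedOptimalQuotient_periodLattice_of_dvd`,
`isIsogenous_iff_frobeniusTrace_eq`, `mazurKenku_exists_cyclic_isogeny`, `heckeSelfDual_torsionBy_J0`,
`buzzard2000_multiplicityOne_gamma0`, `serre1972_supersingular_decompositionSubgroup_image`.  BSD is not proved by this.
[cite: Buzzard2000LevelLoweringModTwo, Prop. 2.4 and Def. 2.1–2.2 (p. 100–101)] [cite: Manin1972, Thm. 1.9] -/
theorem plusLineCharTwo_of_fourFacts
    (hES : eichlerShimura_depletedOptimalQuotient_periodLattice_of_dvd)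
    (hSD : heckeSelfDual_torsionBy_J0) (hBz : buzzard2000_multiplicityOne_gamma0)
    (hSe : serre1972_supersingular_decompositionSubgroup_image) :
    ∀ (W : WeierstrassCurve ℚ) [W.IsElliptic] [W.IsGloballyMinimal], GoodSS W 2 → W.Δ < 0 → ∀ (N' : ℕ), Odd N' →
    ∀ {N : ℕ} [NeZero N] (f : CuspForm (Gamma0 N) 2), IsNewformOf W f →
    ∀ (S : Finset ℕ), (∀ ℓ ∈ S, ℓ.Prime) → S.Nonempty → N * ∏ ℓ ∈ S, ℓ ^ 2 ∣ N' → (∀ p : ℕ, p.Prime → p ∣ N' → p ∈ S) →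
    (∀ v : HeightOneSpectrum (𝓞 ℚ), ¬ ((primesEquiv v : ℕ) ∣ 2 * N') → W.HasGoodReductionAt v) →
    ∀ (k : Type) [Field k] [CharP k 2] (Ψ₁ Ψ₂ : ℚ → k), (∀ (r : ℚ) (z : ℤ), Ψ₁ (r + z) = Ψ₁ r) → (∀ r : ℚ, Ψ₁ (-r) = Ψ₁ r) → (∀ (γ : CongruenceSubgroup.Gamma0 (N')) (r : ℚ), ((γ : SL(2, ℤ)) 1 0 : ℚ) * r + ((γ : SL(2, ℤ)) 1 1 : ℚ) ≠ 0 → Ψ₁ ((((γ : SL(2, ℤ)) 0 0 : ℚ) * r + ((γ : SL(2, ℤ)) 0 1 : ℚ)) / (((γ : SL(2, ℤ)) 1 0 : ℚ) * r + ((γ : SL(2, ℤ)) 1 1 : ℚ))) = (if ((γ : SL(2, ℤ)) 1 0) = 0 then 0 else Ψ₁ ((((γ : SL(2, ℤ)) 0 0 : ℚ)) / (((γ : SL(2, ℤ)) 1 0 : ℚ)))) + Ψ₁ r) → (∀ (r : ℚ) (z : ℤ), Ψ₂ (r + z) = Ψ₂ r) → (∀ r : ℚ, Ψ₂ (-r)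 = Ψ₂ r) → (∀ (γ : CongruenceSubgroup.Gamma0 (N')) (r : ℚ), ((γ : SL(2, ℤ)) 1 0 : ℚ) * r + ((γ : SL(2, ℤ)) 1 1 : ℚ) ≠ 0 → Ψ₂ ((((γ : SL(2, ℤ)) 0 0 : ℚ) * r + ((γ : SL(2, ℤ)) 0 1 : ℚ)) / (((γ : SL(2, ℤ)) 1 0 : ℚ) * r + ((γ : SL(2, ℤ)) 1 1 : ℚ))) = (if ((γ : SL(2, ℤ)) 1 0) = 0 then 0 else Ψ₂ ((((γ : SL(2, ℤ)) 0 0 : ℚ)) / (((γ : SL(2, ℤ)) 1 0 : ℚ)))) + Ψ₂ r) → (∃ r : ℚ, Ψ₁ r ≠ 0) → (∃ r : ℚ, Ψ₂ r ≠ 0) → (∀ q : ℕ, q.Prime → ¬ q ∣ N' → ∀ r : ℚ, (∑ j : Fin q, Ψ₁ ((r + j) / q)) + Ψ₁ (q * r) = (W.LFunction q : k) * Ψ₁ r) → (∀ q : ℕ, q.Prime → ¬ q ∣ N' → ∀ r : ℚ, (∑ j : Fin q, Ψ₂ ((r + j) / q)) + Ψ₂ (q * r) = (W.LFunction q : k)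 * Ψ₂ r) → (∀ ℓ : ℕ, ℓ.Prime → ℓ ∣ N' → ∀ r : ℚ, ∑ j : Fin ℓ, Ψ₁ ((r + j) / ℓ) = 0) → (∀ ℓ : ℕ, ℓ.Prime → ℓ ∣ N' → ∀ r : ℚ, ∑ j : Fin ℓ, Ψ₂ ((r + j) / ℓ) = 0) → ∃ c : k, ∀ r : ℚ, Ψ₂ r = c * Ψ₁ r := by
  intro W _ _ hss hΔ N' hN' N _ f hf S hS hSne hNL hLS hgood k _ _ Ψ₁ Ψ₂ _ hev₁ hM₁ _ hev₂ hM₂ hne₁ _ hT₁ hT₂ hU₁ hU₂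
  haveI : NeZero N' := ⟨by rintro rfl; exact (Nat.not_even_iff_odd.mpr hN') (Even.zero)⟩
  have ha2 : ((W.LFunction 2 : ℤ) : k) = 0 := by
    rw [LFunction_apply_prime_eq_frobeniusTrace W 2 hss.1]
    obtain ⟨m, hm⟩ := hss.2
    rw [hm]
    push_cast
    rw [CharTwo.two_eq_zero, zero_mul]
  exact plusLineCharTwo_of_kTwo hN' (fun n ↦ W.LFunction n) ha2 Ψ₁ Ψ₂ hev₁ hM₁ hev₂ hM₂ hne₁ hT₁ hT₂ hU₁ hU₂
    (fun K h2K hTK hUK hcK x hx y hy hxK hyK ↦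
      kTwo_of_dvd_of_threeFacts hES hSD hBz hSe W hss hΔ hf S hS hSne N' hN' hNL hLS hgood K h2K hTK hUK hcK hx hy hxK hyK)

/-! ## §4. The crux BY NAME from FOUR print facts -/

/-- **THE CRUX `ThetaLayerLambdaCongruenceAtTwo` BY NAME from FOUR print facts {ES, SD, Bz, Se} + Kμ⁺'s FLAT** ((C3⁺) from
`plusLineCharTwo_of_fourFacts`; (μ-W₁) from FLAT; (NR-g) unconditional). BSD is not proved by this.
[cite: GreenbergVatsal2000, §1 (10) and Prop. (2.4) (shape)] [cite: Pollack2003, Conj. 6.3] -/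
theorem thetaLayerLambdaCongruenceAtTwo_of_fourFacts_flatMuZeroAtTwo
    (hES : eichlerShimura_depletedOptimalQuotient_periodLattice_of_dvd)
    (hSD : heckeSelfDual_torsionBy_J0) (hBz : buzzard2000_multiplicityOne_gamma0)
    (hSe : serre1972_supersingular_decompositionSubgroup_image)
    (hflat : ∀ (W : WeierstrassCurve ℚ) [W.IsElliptic] [W.IsGloballyMinimal], ¬ W.HasCM → W.analyticRank = 0 → Literature.NumberTheory.EllipticCurves.Rank1Residual.GoodSS W 2 → W.frobeniusTrace 2 = 0 → W.Δ < 0 → ∀ [NeZero (W.conductorNorm ℤ)] (f : CuspForm (CongruenceSubgroup.Gamma0 (W.conductorNorm ℤ)) 2), Literature.NumberTheory.EllipticCurves.ModularForms.IsNewformOf W f → ∀ (Lplus Lminus : Literature.NumberTheory.EllipticCurves.IwasawaAlgebra 2), Summit.BirchSwinnertonDyer.Rank1Residual.Supersingular.IsPollackPair f 2 Lplus Lminus → ¬ PowerSeries.C (2 : ℤ_[2]) ∣ Lminus) :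
    ThetaLayerLambdaCongruenceAtTwo :=
  thetaLayerLambdaCongruenceAtTwo_of_plusLineLevel_curveMax_nonRoot
    (plusLineAtTwoLevel_of_charTwoLevel (plusLineCharTwo_of_fourFacts hES hSD hBz hSe))
    (stub_curveDepletedSymbolMaxAtTwoPowerCusp_of_flatMuZeroAtTwo hflat) partnerEulerFactorNonRoot

/-- **Kan⁺ `ThetaLayerLambdaCongruenceAtTwo` BY NAME from FIVE Literature named facts + the route item 21437
`SignedMuAnalyticAtTwoPlus`**: Eichler–Shimura (depleted optimal quotient), Hecke self-duality of `J₀[2]`, Buzzard's mod-`2`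
multiplicity one, Serre 1972 Prop. 12, Abbes–Ullmo Thm. A. Faltings, Mazur–Kenku and Deligne are no longer inputs (tree theorems
`isIsogenous_iff_frobeniusTrace_eq_holds`, `IsIsogenous.exists_isCyclic`, `…NonRootUnconditional.partnerEulerFactorNonRoot`).
Conditional on five print facts and on an OPEN item; BSD is not proved by this.
[cite: AbbesUllmo1996, Thm. A] [cite: Pollack2003, Conj. 6.3 and Prop. 6.18 (shape)] -/
theorem thetaLayerLambdaCongruenceAtTwo_of_fiveFacts_abbesUllmo_signedMuAnalytic
    (hES : eichlerShimura_depletedOptimalQuotient_periodLattice_of_dvd)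
    (hSD : heckeSelfDual_torsionBy_J0) (hBz : buzzard2000_multiplicityOne_gamma0)
    (hSe : serre1972_supersingular_decompositionSubgroup_image)
    (hAU : abbesUllmo_not_dvd_maninConstant_of_not_dvd_level)
    (hμ : SignedMuAnalyticAtTwoPlus) :
    ThetaLayerLambdaCongruenceAtTwo :=
  thetaLayerLambdaCongruenceAtTwo_of_fourFacts_flatMuZeroAtTwo hES hSD hBz hSe
    ((Summit.BirchSwinnertonDyer.BirchSwinnertonDyer.Theorems.signedMuAnalyticAtTwoPlus_iff_flatMuZero_of_abbesUllmo hAU).mp hμ)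

/-- **Abbes–Ullmo-free form**: Kan⁺ BY NAME from FOUR Literature named facts, the period-unit statement PER at `2` (inline
hypothesis) and the route item 21437. BSD is not proved by this. [cite: Pollack2003, Prop. 6.18 (shape)] -/
theorem thetaLayerLambdaCongruenceAtTwo_of_fourFacts_periodUnit_signedMuAnalytic
    (hES : eichlerShimura_depletedOptimalQuotient_periodLattice_of_dvd)
    (hSD : heckeSelfDual_torsionBy_J0) (hBz : buzzard2000_multiplicityOne_gamma0)
    (hSe : serre1972_supersingular_decompositionSubgroup_image)
    (hper : ∀ (W : WeierstrassCurve ℚ) [W.IsElliptic] [W.IsGloballyMinimal],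
      Literature.NumberTheory.EllipticCurves.Rank1Residual.GoodSS W 2 →
      ∀ [NeZero (W.conductorNorm ℤ)] (f : CuspForm (Gamma0 (W.conductorNorm ℤ)) 2), IsNewformOf W f →
      ∃ u : ℚ, ‖(u : ℚ_[2])‖ = 1 ∧ W.realPeriodRat = u * plusPeriod f)
    (hμ : SignedMuAnalyticAtTwoPlus) :
    ThetaLayerLambdaCongruenceAtTwo :=
  thetaLayerLambdaCongruenceAtTwo_of_fourFacts_flatMuZeroAtTwo hES hSD hBz hSe
    (Summit.BirchSwinnertonDyer.BirchSwinnertonDyer.Theorems.flatMuZero_of_signedMuAnalyticAtTwoPlus_of_periodUnit hμ hper)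

/-- **Curried form for a route binder list** (the pen's twin «KanP» with FIVE print binders): Eichler–Shimura, Hecke self-duality,
Buzzard, Serre, Abbes–Ullmo, then the item 21437, then the crux — all BY NAME. -/
theorem kanP5_of_pub_of_signedMuAnalyticAtTwoPlus :
    eichlerShimura_depletedOptimalQuotient_periodLattice_of_dvd → heckeSelfDual_torsionBy_J0 →
    buzzard2000_multiplicityOne_gamma0 → serre1972_supersingular_decompositionSubgroup_image →
    abbesUllmo_not_dvd_maninConstant_of_not_dvd_level → SignedMuAnalyticAtTwoPlus → ThetaLayerLambdaCongruenceAtTwo :=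
  thetaLayerLambdaCongruenceAtTwo_of_fiveFacts_abbesUllmo_signedMuAnalytic

end Summit.BirchSwinnertonDyer.BirchSwinnertonDyer.Theorems.ThetaLayerLambdaCongruenceAtTwo

end
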